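import Mathlib
import Summits.Ventures.PercRepro2.UniversalSeriesFibres
import Summits.Ventures.PercRepro2.RelayClosures

/-! # The series step of (UH*) from Package-S
(seat mine-b, cell pub-perc-repro2; MINE-B.md §28.10–28.11)

**Package-S** on a labelled preorder: an (UH*) assignment `f`, a relay `σ` (`IsRelay`: injective on the
blue-positive elements, below, red `≥ 1`, blue drop `≤ 1`) that agrees with `f` on the slot `0` of EVERY
source, and fibre data `A` / `B` for the units of index `≥ 1` only (fibre index `≥ 1`).  The unit `0` of every
source `(x, z)` of `X ∧ Y` goes to `(σ x, τ z)` — the lane's rule (I) in both factors at once — and the units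
`≥ 1` to the fibre data.  This is `universal_ser_of_fibres` with `A x z 0 := (0, τ z)` and `B z u 0 := (0, σ u)`:
the unit clause of the avoidance is the injectivity of `τ` (a unit source `z'` with `g (z', 0) = τ z' = τ z`
would force `z' = z`), the index clause is empty at fibre `0`, and the relay's blue drop gives the level.
The point of Package-S (§28.10): its relay component is closed under `ser` and `par` (RelayClosures.lean), so
the closure of (UH*) along series composition rests on the fibre data of the product alone. -/

namespace Summit.Ventures.PercRepro2.UHClosure

open Finset
open Summit.Ventures.PercRepro2.V2Closure (serR serB IsRelay)

variable {X Y : Type*} [Preorder X] [Preorder Y] [Fintype X] [Fintype Y]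

section packageS

variable (r b : X → ℕ) (r' b' : Y → ℕ)
variable (f : SlotL (USrc r b) b → X) (g : SlotL (USrc r' b') b' → Y)
variable (σ : X → X) (τ : Y → Y) (A : X → Y → ℕ → ℕ × Y) (B : Y → X → ℕ → ℕ × X)

omit [Preorder X] [Preorder Y] in
/-- the fibre data extended to the unit `0` by the relay of the second factor -/
def extA (τ : Y → Y) (A : X → Y → ℕ → ℕ × Y) (x : X) (z : Y) (k : ℕ) : ℕ × Y :=
  if k = 0 then (0, τ z) else A x z k

omit [Preorder X] [Preorder Y] in
/-- the fibre data extended to the unit `0` by the relay of the first factor -/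
def extB (σ : X → X) (B : Y → X → ℕ → ℕ × X) (z : Y) (u : X) (k : ℕ) : ℕ × X :=
  if k = 0 then (0, σ u) else B z u k

omit [Preorder X] [Preorder Y] in
/-- a slot of a unit source has index `0` -/
lemma idx_zero_of_unit {p : SlotL (USrc r b) b} (h : b p.1.1.1 = 1) : p.1.2.val = 0 := by
  have := p.2; omega

/-- **THE SERIES STEP OF (UH*) FROM PACKAGE-S.** -/
theorem universal_ser_of_packageS
    (hf : Function.Injective f) (hfs : ∀ p, f p ≤ p.1.1.1 ∧ r (f p) = 1 ∧ b p.1.1.1 ≤ b (f p) + 1)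
    (hg : Function.Injective g) (hgs : ∀ p, g p ≤ p.1.1.1 ∧ r' (g p) = 1 ∧ b' p.1.1.1 ≤ b' (g p) + 1)
    (hσ : IsRelay r b σ) (hτ : IsRelay r' b' τ)
    (hτg : ∀ p : SlotL (USrc r' b') b', p.1.2.val = 0 → τ p.1.1.1 = g p)
    (hA1 : ∀ x z k, DomA r b r' b' x z k → 1 ≤ k → 1 ≤ (A x z k).1 ∧ (A x z k).1 < b x)
    (hA2 : ∀ x z k, DomA r b r' b' x z k → 1 ≤ k → (A x z k).2 ≤ z)
    (hA3 : ∀ x z k, DomA r b r' b' x z k → 1 ≤ k → 1 ≤ r' (A x z k).2)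
    (hA4 : ∀ x z k, DomA r b r' b' x z k → 1 ≤ k → min (b x) (b' z) ≤ b' (A x z k).2 + 1)
    (hA5 : ∀ x z k, DomA r b r' b' x z k → 1 ≤ k → ∀ p : SlotL (USrc r' b') b',
      p.1.2.val < (A x z k).1 → g p ≠ (A x z k).2)
    (hA6 : ∀ x z k z' k', DomA r b r' b' x z k → DomA r b r' b' x z' k' → 1 ≤ k → 1 ≤ k' →
      A x z k = A x z' k' → z = z' ∧ k = k')
    (hB1 : ∀ z u k, DomB r b r' b' z u k → 1 ≤ k → 1 ≤ (B z u k).1 ∧ (B z u k).1 < b' z)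
    (hB2 : ∀ z u k, DomB r b r' b' z u k → 1 ≤ k → (B z u k).2 ≤ u)
    (hB3 : ∀ z u k, DomB r b r' b' z u k → 1 ≤ k → 1 ≤ r (B z u k).2)
    (hB4 : ∀ z u k, DomB r b r' b' z u k → 1 ≤ k → min (b' z) (b u) ≤ b (B z u k).2 + 1)
    (hB5 : ∀ z u k, DomB r b r' b' z u k → 1 ≤ k → ∀ p : SlotL (USrc r b) b,
      p.1.2.val ≤ (B z u k).1 → f p ≠ (B z u k).2)
    (hB6 : ∀ z u k u' k', DomB r b r' b' z u k → DomB r b r' b' z u' k' → 1 ≤ k → 1 ≤ k' →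
      B z u k = B z u' k' → u = u' ∧ k = k')
    (hσ0 : ∀ p : SlotL (USrc r b) b, p.1.2.val = 0 → σ p.1.1.1 = f p) :
    Universal (serR r r') (serB b b') := by
  have hσi := hσ.1
  have hσs := hσ.2
  have hτi := hτ.1
  have hτs := hτ.2
  -- the extended data satisfy the hypotheses of `universal_ser_of_fibres`
  have eA1 : ∀ x z k, USrc r b x → 2 ≤ b x → 1 ≤ b' z → ¬ (r' z = 0 ∧ b' z = 1) → k < min (b x) (b' z) →
      (extA τ A x z k).1 < b x := by
    intro x z k hx h2 hz hnu hk
    unfold extA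
    split_ifs with h0
    · simp only; omega
    · exact (hA1 x z k ⟨hx, h2, hz, hnu, hk⟩ (by omega)).2
  have eB1 : ∀ z u k, USrc r' b' z → 2 ≤ b' z → 1 ≤ r u → 1 ≤ b u → k < min (b' z) (b u) →
      (extB σ B z u k).1 < b' z := by
    intro z u k hz h2 hr hb hk
    unfold extB
    split_ifs with h0
    · simp only; omega
    · exact (hB1 z u k ⟨hz, h2, hr, hb, hk⟩ (by omega)).2
  refine universal_ser_of_fibres r b r' b' f g σ τ (extA τ A) (extB σ B) eA1 eB1 hf hfs hg hgs
    (fun x x' hx hx' h => hσi x x' hx hx' h) (fun x hx => ⟨(hσs x hx).1, (hσs x hx).2.1⟩)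
    (fun z z' hz hz' h => hτi z z' hz hz' h) (fun z hz => ⟨(hτs z hz).1, (hτs z hz).2.1⟩)
    (fun p hp => hτg p (idx_zero_of_unit r' b' hp)) ?_ ?_ ?_ ?_ ?_ ?_ ?_ ?_ ?_ ?_
  · -- hA2
    intro x z k hd; unfold extA; split_ifs with h0
    · exact (hτs z hd.2.2.1).1
    · exact hA2 x z k hd (by omega)
  · -- hA3
    intro x z k hd; unfold extA; split_ifs with h0
    · exact (hτs z hd.2.2.1).2.1
    · exact hA3 x z k hd (by omega)
  · -- hA4
    intro x z k hd; unfold extA; split_ifs with h0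
    · have := (hτs z hd.2.2.1).2.2; simp only; omega
    · exact hA4 x z k hd (by omega)
  · -- hA5
    intro x z k hd p hp; unfold extA at hp ⊢; split_ifs at hp ⊢ with h0
    · simp only at hp ⊢
      rcases hp with hu | hu
      · intro he
        have h1 := hτg p (idx_zero_of_unit r' b' hu)
        have hz : p.1.1.1 = z := hτi p.1.1.1 z (by omega) hd.2.2.1 (by rw [h1]; exact he)
        apply hd.2.2.2.1
        refine ⟨?_, ?_⟩
        · rw [← hz]; exact p.1.1.2.1.1
        · rw [← hz]; exact hu
      · omega
    · rcases hp with hu | hu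
      · have h0' := idx_zero_of_unit r' b' hu
        exact hA5 x z k hd (by omega) p (by rw [h0']; exact (hA1 x z k hd (by omega)).1)
      · exact hA5 x z k hd (by omega) p hu
  · -- hA6
    intro x z k z' k' hd hd' he; unfold extA at he; split_ifs at he with h0 h0' h0'
    · have := hτi _ _ hd.2.2.1 hd'.2.2.1 (by simpa using congrArg Prod.snd he); exact ⟨this, by omega⟩
    · exfalso; have := (hA1 x z' k' hd' (by omega)).1; have := congrArg Prod.fst he; simp at this; omega
    · exfalso; have := (hA1 x z k hd (by omega)).1; have := congrArg Prod.fst he; simp at this; omega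
    · exact hA6 x z k z' k' hd hd' (by omega) (by omega) he
  · -- hB2
    intro z u k hd; unfold extB; split_ifs with h0
    · exact (hσs u hd.2.2.2.1).1
    · exact hB2 z u k hd (by omega)
  · -- hB3
    intro z u k hd; unfold extB; split_ifs with h0
    · exact (hσs u hd.2.2.2.1).2.1
    · exact hB3 z u k hd (by omega)
  · -- hB4
    intro z u k hd; unfold extB; split_ifs with h0
    · have := (hσs u hd.2.2.2.1).2.2; simp only; omega
    · exact hB4 z u k hd (by omega)
  · -- hB5
    intro z u k hd p hp; unfold extB at hp ⊢; split_ifs at hp ⊢ with h0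
    · simp only at hp ⊢
      intro he
      have h1 := hσ0 p (by omega)
      have hu : p.1.1.1 = u := hσi p.1.1.1 u p.1.1.2.2 hd.2.2.2.1 (by rw [h1]; exact he)
      have := p.1.1.2.1.1
      rw [hu] at this
      have := hd.2.2.1
      omega
    · exact hB5 z u k hd (by omega) p hp
  · -- hB6
    intro z u k u' k' hd hd' he; unfold extB at he; split_ifs at he with h0 h0' h0'
    · have := hσi _ _ hd.2.2.2.1 hd'.2.2.2.1 (by simpa using congrArg Prod.snd he); exact ⟨this, by omega⟩
    · exfalso; have := (hB1 z u' k' hd' (by omega)).1; have := congrArg Prod.fst he; simp at this; omega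
    · exfalso; have := (hB1 z u k hd (by omega)).1; have := congrArg Prod.fst he; simp at this; omega
    · exact hB6 z u k u' k' hd hd' (by omega) (by omega) he

end packageS

end Summit.Ventures.PercRepro2.UHClosure
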